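import Literature.NumberTheory.EllipticCurves.SupersingularDensityDeuringCriterionProofs
import HarnessLib

/-!
# The Frobenius eigenvalue on a cyclic `p^k`-torsion packet of an elliptic curve over a finite field:
# an integer root of `X² − aX + q` modulo `p^k`, prime to `p` (the unit root)

Cell `bsd-print-cf2`, seat `bsd-line-cf2-p1-w2` g5; ROUTE-FREE helper toward crux stmt-BirchSwinnertonDyer-20368 (`--supports`, brick F-A-core of
the discharge road of `stub_finLoc_two`, see `Cruxes/SplitBadTwoRankOneOfFacts/TURNKEY-20368-finLoc-w2g5.md`). THEOREMS ONLY (no definition,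
no named fact, no `sorry`); closes nothing by itself; BSD is not advanced by any of this; no summit statement is proved by this seat.
For an elliptic curve `W` over a finite field `k` with `q` elements, `a = q + 1 − #W(k)`, and the arithmetic Frobenius
`σ_q ∈ Γ_k` (`σ_q x = x^q`), Manin's relation `σ_q² − a σ_q + q = 0` holds on `W(k̄)` (Silverman, *AEC*, Thm. V.2.3.1(b); tree
`frobenius_frobenius_sub_trace_smul_add_card_smul`). Read on a CYCLIC `σ_q`-stable subgroup `S = ℤ·y₀ ≤ W(k̄)` with `y₀` of order
`p^k` — at an ORDINARY curve, `S = W(k̄)[p^k] ≅ ℤ/p^k` (Silverman V.3.1) — it says that `σ_q` acts on `S` as an INTEGER `u` with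
`u² − a u + q ≡ 0 (mod p^k)` and `p ∤ u` (`σ_q` is injective on points): `u` is the unit root of `X² − aX + q` to precision `p^k`
(Mazur 1972; Greenberg, LNM 1716, §2 pp. 62–63: "Frobenius acts on `Ẽ[p^∞]` by the unit root `α`"; the docstring of the tree's
`GeomReductionFrobeniusProofs` records the level-`p` case `u ≡ a (mod p)` and names the higher levels as not yet in the tree).

* §1 (group theory) `exists_mem_addOrderOf_eq_pow_of_card` — a subgroup of order `p^k` killed by `p^k`, in a group whose
  `p^{k−1}`-torsion has at most `p^{k−1}` elements, contains an element of order `p^k`; `forall_mem_exists_zsmul_of_addOrderOf_eq_card` —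
  and is then generated by it.
* §2 `exists_int_frobenius_smul_eq_of_zmultiples` — the eigenvalue `u` with Manin's congruence `addOrderOf y₀ ∣ u² − a u + q`;
  `not_dvd_of_frobenius_smul_eq` — `p ∤ u` as soon as `p ∣ addOrderOf y₀`.

Consumers: the ordinary filtration at a place `v ∣ p` of a number field (Greenberg 1991 §2, tree
`ellipticOrdinaryReduction_tateModule_filtration_holds`) read at the level of `E[p^k]` with the Frobenius eigenvalue on the quotient
`E[p^k]/X ≅ Ẽ_v[p^k]` (crux stmt-BirchSwinnertonDyer-20368 `stub_finLoc_two` via `EisensteinTwo.finLoc_two_of_ordinaryFiltration`; crux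
stmt-BirchSwinnertonDyer-19546 `stub_finV_gordTwo_of_lineCharacter`). Nothing here asserts those.

References: [SilvermanAEC2009] Thm. V.2.3.1(b), Thm. V.3.1; [GreenbergLNM1716] §2 pp. 62–63; B. Mazur, *Rational points of abelian
varieties with values in towers of number fields*, Invent. Math. 18 (1972), §4.
-/

noncomputable section

open scoped Classical

namespace Summit.BirchSwinnertonDyer.BirchSwinnertonDyer.Theorems.OrdinaryFrobenius

set_option linter.dupNamespace false
set_option autoImplicit false

/-! ## §1 Group theory: a subgroup of order `p^k` and exponent `p^k` over a small `p^{k-1}`-torsion is cyclic -/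

section Group

variable {B : Type*} [AddCommGroup B] {p : ℕ}

/-- **An element of order `p^k`.** If `S ≤ B` has `p^k` elements, is killed by `p^k`, and `B` has at most `p^{k−1}` elements killed
by `p^{k−1}` (`k ≥ 1`), then some `y₀ ∈ S` has order exactly `p^k` (otherwise every element of `S` would be killed by `p^{k−1}`).
[folklore] -/
theorem exists_mem_addOrderOf_eq_pow_of_card (hp : p.Prime) {k : ℕ} (hk : 0 < k) (S : AddSubgroup B)
    (hS : Nat.card S = p ^ k) (hSk : ∀ y ∈ S, p ^ k • y = 0)
    (hsmall : ∀ T : Finset B, (∀ y ∈ T, p ^ (k - 1) • y = 0) → T.card ≤ p ^ (k - 1)) :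
    ∃ y₀ ∈ S, addOrderOf y₀ = p ^ k := by
  haveI : Finite S := Nat.finite_of_card_ne_zero (by rw [hS]; exact pow_ne_zero _ hp.ne_zero)
  by_contra hne
  push Not at hne
  -- every element of `S` is killed by `p^{k-1}`
  have hkill : ∀ y ∈ S, p ^ (k - 1) • y = 0 := by
    intro y hy
    have hdvd : addOrderOf y ∣ p ^ k := addOrderOf_dvd_of_nsmul_eq_zero (hSk y hy)
    obtain ⟨j, hj, hord⟩ := (Nat.dvd_prime_pow hp).mp hdvd
    have hjk : j ≠ k := fun h ↦ hne y hy (by rw [hord, h])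
    have hjle : j ≤ k - 1 := by omega
    have : addOrderOf y ∣ p ^ (k - 1) := by rw [hord]; exact pow_dvd_pow p hjle
    exact addOrderOf_dvd_iff_nsmul_eq_zero.mp this
  -- so `#S ≤ p^{k-1} < p^k`
  have hfin : (S : Set B).Finite := Set.toFinite _
  set T : Finset B := hfin.toFinset with hT
  have hTS : ∀ y, y ∈ T ↔ y ∈ S := fun y ↦ by rw [hT, Set.Finite.mem_toFinset]; rfl
  have hcard : T.card = p ^ k := by
    have h1 : Nat.card S = (S : Set B).ncard := Nat.card_coe_set_eq (S : Set B)
    rw [← hS, h1, hT, Set.ncard_eq_toFinset_card _ hfin]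
  have hle := hsmall T (fun y hy ↦ hkill y ((hTS y).mp hy))
  rw [hcard] at hle
  have hlt : p ^ (k - 1) < p ^ k := Nat.pow_lt_pow_right hp.one_lt (by omega)
  omega

/-- **… generates it.** If `y₀ ∈ S` has order `#S` (finite), then every element of `S` is an integer multiple of `y₀`. [folklore] -/
theorem forall_mem_exists_zsmul_of_addOrderOf_eq_card (S : AddSubgroup B) [Finite S] {y₀ : B} (hy₀ : y₀ ∈ S)
    (hord : addOrderOf y₀ = Nat.card S) : ∀ y ∈ S, ∃ m : ℤ, y = m • y₀ := by
  have hle : AddSubgroup.zmultiples y₀ ≤ S := AddSubgroup.zmultiples_le_of_mem hy₀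
  have hcard : Nat.card S ≤ Nat.card (AddSubgroup.zmultiples y₀) := by
    rw [Nat.card_zmultiples, hord]
  have heq : AddSubgroup.zmultiples y₀ = S := AddSubgroup.eq_of_le_of_card_ge hle hcard
  intro y hy
  rw [← heq, AddSubgroup.mem_zmultiples_iff] at hy
  obtain ⟨m, hm⟩ := hy
  exact ⟨m, hm.symm⟩

end Group

/-! ## §2 The Frobenius eigenvalue on a cyclic stable packet -/

section Frobenius

variable {K : Type} [Field K] [Finite K] (W : WeierstrassCurve K) [W.IsElliptic]
  {σ : Field.absoluteGaloisGroup K} (hσ : ∀ x : AlgebraicClosure K, σ • x = x ^ Nat.card K)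

include hσ in
/-- **The Frobenius eigenvalue.** `W/k` elliptic over a finite field with `q = #k` elements, `a = q + 1 − #W(k)`, `σ = σ_q` the arithmetic
Frobenius; `S ≤ W(k̄)` a subgroup generated by `y₀` with `σ y₀ ∈ S`. Then `σ` acts on `S` as an integer `u` — `σ y = u • y` for all `y ∈ S` —
and Manin's relation `σ² − aσ + q = 0` on `W(k̄)` (Silverman V.2.3.1(b)) gives `addOrderOf y₀ ∣ u² − a u + q`.
[cite: SilvermanAEC2009, Thm. V.2.3.1(b)] [cite: GreenbergLNM1716, §2 pp. 62–63 (the unit root acting on Ẽ[p^∞])] -/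
theorem exists_int_frobenius_smul_eq_of_zmultiples (S : AddSubgroup W.geomPoints) {y₀ : W.geomPoints}
    (hgen : ∀ y ∈ S, ∃ m : ℤ, y = m • y₀) (hstab : σ • y₀ ∈ S) :
    ∃ u : ℤ, (∀ y ∈ S, σ • y = u • y) ∧
      ((addOrderOf y₀ : ℤ) ∣ u ^ 2 - ((Nat.card K : ℤ) + 1 - Nat.card W.toAffine.Point) * u + Nat.card K) := by
  obtain ⟨u, hu⟩ := hgen _ hstab
  have hzs : ∀ (m : ℤ) (P : W.geomPoints), σ • (m • P) = m • σ • P := fun m P ↦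
    map_zsmul (W.frobeniusIsogeny hσ).toAddMonoidHom m P
  refine ⟨u, fun y hy ↦ ?_, ?_⟩
  · obtain ⟨m, rfl⟩ := hgen y hy
    rw [hzs, hu, smul_comm]
  · rw [addOrderOf_dvd_iff_zsmul_eq_zero]
    have hM := WeierstrassCurve.frobenius_frobenius_sub_trace_smul_add_card_smul W hσ y₀
    rw [hu, hzs, hu, smul_smul] at hM
    have e : (u ^ 2 - ((Nat.card K : ℤ) + 1 - Nat.card W.toAffine.Point) * u + Nat.card K) • y₀ =
        (u * u) • y₀ - ((Nat.card K : ℤ) + 1 - Nat.card W.toAffine.Point) • u • y₀ +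
          ((Nat.card K : ℕ) : ℤ) • y₀ := by
      module
    rw [e]
    exact hM

omit [Finite K] [W.IsElliptic] in
/-- **The eigenvalue is a unit.** If `σ y₀ = u • y₀` for the arithmetic Frobenius `σ` (injective on points) and `p ∣ addOrderOf y₀`, then
`p ∤ u`. [folklore] -/
theorem not_dvd_of_frobenius_smul_eq {p : ℕ} (hp : p.Prime) {y₀ : W.geomPoints} {u : ℤ} (hu : σ • y₀ = u • y₀)
    (hpy : p ∣ addOrderOf y₀) (hfin : 0 < addOrderOf y₀) : ¬ (p : ℤ) ∣ u := by
  rintro ⟨u', rfl⟩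
  obtain ⟨m', hm'⟩ := hpy
  -- `σ (m' • y₀) = u' • (p m') • y₀ = 0`, so `m' • y₀ = 0`, contradicting the order
  have hzero : σ • ((m' : ℤ) • y₀) = 0 := by
    change (DistribSMul.toAddMonoidHom W.geomPoints σ) ((m' : ℤ) • y₀) = 0
    rw [map_zsmul]
    change (m' : ℤ) • σ • y₀ = 0
    rw [hu, smul_smul, show (m' : ℤ) * (p * u') = u' * ((p * m' : ℕ) : ℤ) by push_cast; ring, mul_smul,
      natCast_zsmul, ← hm', addOrderOf_nsmul_eq_zero, smul_zero]
  have hm'0 : (m' : ℤ) • y₀ = 0 := by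
    have := congrArg (fun P ↦ σ⁻¹ • P) hzero
    simpa only [inv_smul_smul, smul_zero] using this
  rw [natCast_zsmul] at hm'0
  have hdvd : addOrderOf y₀ ∣ m' := addOrderOf_dvd_of_nsmul_eq_zero hm'0
  have hp1 : 1 < p := hp.one_lt
  have hm'pos : 0 < m' := by
    rcases Nat.eq_zero_or_pos m' with h | h
    · rw [h, mul_zero] at hm'; omega
    · exact h
  have := Nat.le_of_dvd hm'pos hdvd
  rw [hm'] at this
  nlinarith

end Frobenius

/-! ## §3 At `p = 2`, `q = 2`, `a = 1`: the odd root of `X² − X + 2` modulo `2^k` is the unit root (appended by the same seat) -/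

section OddRoot

/-- **The odd root is the unit root.** For a unit `α ∈ ℤ₂` with `α² = α − 2` (the `2`-adic unit root of `X² − X + 2`; the other root
`1 − α = 2/α` is even) and an ODD integer `u` with `u² − u + 2 ≡ 0 (mod 2^k)`: `u ≡ α (mod 2^k)`. Proof: `(u − α)(u − 1 + α) = u² − u + 2`
in `ℤ₂` and `u − 1 + α` is a unit (`‖u − 1‖ < 1 = ‖α‖`). No Hensel lifting is needed. (With §2 at a degree-one place above `2` of good
ordinary reduction with `a_v = 1` — e.g. the conductor-`49` curves, `#Ẽ(𝔽₂) = 2` — the Frobenius eigenvalue on `Ẽ[2^k]` is `≡ α`.) [folklore] -/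
theorem intCast_sub_unitRoot_mem_span_pow_of_odd (α : ℤ_[2]ˣ) (hα : (α : ℤ_[2]) ^ 2 = (α : ℤ_[2]) - 2) {u : ℤ}
    (hu : Odd u) {k : ℕ} (h : (2 : ℤ) ^ k ∣ u ^ 2 - u + 2) :
    ((u : ℤ_[2]) - α) ∈ (Ideal.span {(2 : ℤ_[2]) ^ k} : Ideal ℤ_[2]) := by
  -- `(u − α)(u − 1 + α) = u² − u + 2`
  have hfac : ((u : ℤ_[2]) - α) * ((u : ℤ_[2]) - 1 + α) = (u : ℤ_[2]) ^ 2 - u + 2 := by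
    linear_combination (-1 : ℤ_[2]) * hα
  -- `u − 1 + α` is a unit: `‖u − 1‖ < 1`, `‖α‖ = 1`
  have hunit : IsUnit ((u : ℤ_[2]) - 1 + α) := by
    rw [PadicInt.isUnit_iff]
    have h1 : ‖((u : ℤ_[2]) - 1)‖ < 1 := by
      obtain ⟨m, rfl⟩ := hu
      push_cast
      rw [show (2 : ℤ_[2]) * m + 1 - 1 = 2 * m by ring, norm_mul]
      have h2 : ‖(2 : ℤ_[2])‖ < 1 := by
        have := PadicInt.norm_p (p := 2)
        rw [show ((2 : ℕ) : ℤ_[2]) = 2 by norm_num] at this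
        rw [this]; norm_num
      calc ‖(2 : ℤ_[2])‖ * ‖(m : ℤ_[2])‖ ≤ ‖(2 : ℤ_[2])‖ * 1 := by
            gcongr; exact PadicInt.norm_le_one _
        _ < 1 := by rw [mul_one]; exact h2
    have hα1 : ‖(α : ℤ_[2])‖ = 1 := PadicInt.isUnit_iff.mp α.isUnit
    rw [PadicInt.norm_add_eq_max_of_ne (by rw [hα1]; exact h1.ne), hα1]
    exact max_eq_right h1.le
  -- divide by the unit
  have hmem : (u : ℤ_[2]) ^ 2 - u + 2 ∈ (Ideal.span {(2 : ℤ_[2]) ^ k} : Ideal ℤ_[2]) := by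
    obtain ⟨c, hc⟩ := h
    refine Ideal.mem_span_singleton.mpr ⟨(c : ℤ_[2]), ?_⟩
    have := congrArg (Int.cast : ℤ → ℤ_[2]) hc
    push_cast at this
    exact this
  rw [← hfac] at hmem
  exact (Ideal.unit_mul_mem_iff_mem _ hunit).mp (by rw [mul_comm]; exact hmem)

end OddRoot

end Summit.BirchSwinnertonDyer.BirchSwinnertonDyer.Theorems.OrdinaryFrobenius

end
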